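import Summits.PneNP.PneNP.Theorems.PhaseTwinsMacroscopicTwinsAboveDefs

/-!
# Route PhaseTwins, crux `MacroscopicTwinsAbove` (stmt-PneNP-2720), line `literal-gadgets-cfi-apparatus`: stub `stub_parameters`

The parameter regime of the line is nonempty (pure asymptotic bookkeeping, no cited fact): there is ONE
gadget size `n ≥ N₀` together with numbers `K ≥ 1`, `κ₁` such that the `κ₁` pair slots and the `D·K` end
slots fit into the `slyM d θ n` ports of a side, the sector inequality `K D Lρ ≤ κ₁ LB` holds,
`n^{-2θ} ≤ 1/2` and `1 + 2 log (3n) ≤ K η g`. Witnesses: `K = ⌈(1 + 2 log (3n))/(η g)⌉₊` and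
`κ₁ = ⌈K D max(Lρ, 0)/LB⌉₊`; both are `O(log n)`, while `slyM d θ n ≥ slyK θ n = ⌊n^{3θ/4}⌋₊` as soon as
`d - 1 ≤ n^{θ/4}` (tree lemma `mul_slyK_le_slyM` with `N = 1`) and `log n = o(n^{3θ/4})`
(`isLittleO_log_rpow_atTop`). The finitely many thresholds on `n` are collected with `Filter.eventually_atTop`.
-/

noncomputable section

open scoped Classical BigOperators

namespace Summit.PneNP.PneNP.Cruxes.MacroscopicTwinsAbove.LiteralGadgetsCfiApparatus

open Literature.Computability.Complexity (slyM slyK mul_slyK_le_slyM)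

-- `Summit.PneNP.PneNP.…` (summit = sub-problem name) trips the duplicate-namespace linter on every declaration.
set_option linter.dupNamespace false

variable {nv m v P κ₁ D K : ℕ}

/-- `c log n ≤ n^r / 2` for all large naturals `n` (`r > 0`), from `log = o(x^r)` at `+∞`. -/
private theorem eventually_const_mul_log_le_half_rpow {r : ℝ} (hr : 0 < r) (c : ℝ) :
    ∀ᶠ n : ℕ in Filter.atTop, c * Real.log n ≤ 1 / 2 * (n : ℝ) ^ r := by
  have hlo := ((isLittleO_log_rpow_atTop hr).const_mul_left c).bound (by norm_num : (0 : ℝ) < 1 / 2)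
  filter_upwards [tendsto_natCast_atTop_atTop.eventually hlo] with n hn
  have ha : c * Real.log n ≤ ‖c * Real.log (n : ℝ)‖ := Real.le_norm_self _
  have hb : ‖(n : ℝ) ^ r‖ = (n : ℝ) ^ r := Real.norm_of_nonneg (Real.rpow_nonneg (Nat.cast_nonneg n) _)
  linarith [hb ▸ hn]

/-- `c ≤ n^r / 2` for all large naturals `n` (`r > 0`). -/
private theorem eventually_const_le_half_rpow {r : ℝ} (hr : 0 < r) (c : ℝ) :
    ∀ᶠ n : ℕ in Filter.atTop, c ≤ 1 / 2 * (n : ℝ) ^ r :=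
  (Filter.Tendsto.const_mul_atTop (by norm_num : (0 : ℝ) < 1 / 2)
    ((tendsto_rpow_atTop hr).comp tendsto_natCast_atTop_atTop)).eventually_ge_atTop c

/-- `n^{-r} ≤ 1/2` for all large naturals `n` (`r > 0`). -/
private theorem eventually_rpow_neg_le_half {r : ℝ} (hr : 0 < r) :
    ∀ᶠ n : ℕ in Filter.atTop, (n : ℝ) ^ (-r) ≤ 1 / 2 := by
  have ht : Filter.Tendsto (fun n : ℕ => (n : ℝ) ^ (-r)) Filter.atTop (nhds 0) :=
    (tendsto_rpow_neg_atTop hr).comp tendsto_natCast_atTop_atTop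
  exact ht.eventually_le_const (by norm_num)

/-- **S7 — the parameter regime of the line is nonempty.** For `θ > 0`, `d ≥ 3`, `η, g, LB > 0`, any `Lρ`,
`D` and `N₀` there are a gadget size `n ≥ N₀`, `n > 0`, and numbers `K ≥ 1`, `κ₁` with
`κ₁ + D K ≤ slyM d θ n` (the pair and end slots fit into the ports of one side), `K D Lρ ≤ κ₁ LB` (the sector
inequality), `n^{-2θ} ≤ 1/2` and `1 + 2 log (3n) ≤ K η g` (witnesses `K = ⌈(1 + 2 log (3n))/(η g)⌉₊`,
`κ₁ = ⌈K D max(Lρ, 0)/LB⌉₊`, `n` large). -/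
theorem stub_parameters {θ : ℝ} (hθ : 0 < θ) {d : ℕ} (hd : 3 ≤ d) (D : ℕ) {η g LB : ℝ} (hη : 0 < η)
    (hg : 0 < g) (hLB : 0 < LB) (Lρ : ℝ) (N₀ : ℕ) :
    ∃ n K κ₁ : ℕ, N₀ ≤ n ∧ 0 < n ∧ 1 ≤ K ∧
      Fintype.card (Fin κ₁ ⊕ (Fin D × Fin K)) ≤ slyM d θ n ∧
      (K * D : ℝ) * Lρ ≤ κ₁ * LB ∧
      (n : ℝ) ^ (-(2 * θ)) ≤ 1 / 2 ∧
      1 + 2 * Real.log (3 * n) ≤ K * η * g := by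
  have hηg : 0 < η * g := mul_pos hη hg
  -- the constants: `κ₁ + D K ≤ K A + 1 ≤ C₁ log n + C₂`
  obtain ⟨A, hA⟩ : ∃ A : ℝ, A = (D : ℝ) * max Lρ 0 / LB + D := ⟨_, rfl⟩
  have hA0 : 0 ≤ A := by rw [hA]; positivity
  obtain ⟨C₁, hC₁⟩ : ∃ C₁ : ℝ, C₁ = 2 * A / (η * g) := ⟨_, rfl⟩
  obtain ⟨C₂, hC₂⟩ : ∃ C₂ : ℝ, C₂ = (1 + 2 * Real.log 3) / (η * g) * A + A + 1 := ⟨_, rfl⟩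
  -- the finitely many thresholds on `n`
  have h34 : (0 : ℝ) < 3 * θ / 4 := by positivity
  obtain ⟨n, hnN₀, hn1, hlog, hC, hdn, hδ⟩ := ((Filter.eventually_ge_atTop N₀).and
    ((Filter.eventually_ge_atTop 1).and
    ((eventually_const_mul_log_le_half_rpow h34 C₁).and
    ((eventually_const_le_half_rpow h34 (C₂ + 1)).and
    ((eventually_const_le_half_rpow (by positivity : (0 : ℝ) < θ / 4) ((d : ℝ) - 1)).and
    (eventually_rpow_neg_le_half (by positivity : (0 : ℝ) < 2 * θ))))))).exists
  have hnpos : (0 : ℝ) < n := by exact_mod_cast hn1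
  have hnr1 : (1 : ℝ) ≤ n := by exact_mod_cast hn1
  -- `L = 1 + 2 log (3 n) = 1 + 2 log 3 + 2 log n ≥ 1`
  obtain ⟨L, hL⟩ : ∃ L : ℝ, L = 1 + 2 * Real.log (3 * n) := ⟨_, rfl⟩
  have hL3 : Real.log (3 * (n : ℝ)) = Real.log 3 + Real.log n := Real.log_mul (by norm_num) hnpos.ne'
  have hlog0 : 0 ≤ Real.log (3 * (n : ℝ)) := Real.log_nonneg (by linarith)
  have hL1 : 1 ≤ L := by rw [hL]; linarith
  have hLpos : 0 < L / (η * g) := div_pos (by linarith) hηg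
  -- `K = ⌈L/(η g)⌉₊`
  obtain ⟨K', hK'⟩ : ∃ K' : ℕ, K' = ⌈L / (η * g)⌉₊ := ⟨_, rfl⟩
  have hKge : L / (η * g) ≤ K' := hK' ▸ Nat.le_ceil _
  have hKlt : (K' : ℝ) < L / (η * g) + 1 := hK' ▸ Nat.ceil_lt_add_one hLpos.le
  have hK1 : 1 ≤ K' := hK' ▸ Nat.one_le_ceil_iff.2 hLpos
  -- `κ₁ = ⌈K D max(Lρ, 0)/LB⌉₊`
  have hk0 : 0 ≤ (K' : ℝ) * D * max Lρ 0 / LB := by positivity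
  obtain ⟨k₁, hk₁⟩ : ∃ k₁ : ℕ, k₁ = ⌈(K' : ℝ) * D * max Lρ 0 / LB⌉₊ := ⟨_, rfl⟩
  have hkge : (K' : ℝ) * D * max Lρ 0 / LB ≤ k₁ := hk₁ ▸ Nat.le_ceil _
  have hklt : (k₁ : ℝ) < (K' : ℝ) * D * max Lρ 0 / LB + 1 := hk₁ ▸ Nat.ceil_lt_add_one hk0
  refine ⟨n, K', k₁, hnN₀, by omega, hK1, ?_, ?_, hδ, ?_⟩
  · -- the slots fit: `κ₁ + D K ≤ K A + 1 ≤ C₁ log n + C₂ ≤ n^{3θ/4} - 1 ≤ slyK θ n ≤ slyM d θ n`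
    have hcard : Fintype.card (Fin k₁ ⊕ (Fin D × Fin K')) = k₁ + D * K' := by
      simp only [Fintype.card_sum, Fintype.card_prod, Fintype.card_fin]
    have hκ : (n : ℝ) ^ (3 * θ / 4) - 1 ≤ (slyK θ n : ℝ) := by
      unfold slyK
      have := Nat.lt_floor_add_one ((n : ℝ) ^ (3 * θ / 4))
      linarith
    have h1 : (k₁ : ℝ) + D * K' ≤ K' * A + 1 := by
      have h0 : (K' : ℝ) * A = (K' : ℝ) * D * max Lρ 0 / LB + D * K' := by rw [hA]; ring
      linarith
    have h2 : (K' : ℝ) * A + 1 ≤ C₁ * Real.log n + C₂ := by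
      have h3 : (K' : ℝ) * A ≤ (L / (η * g) + 1) * A := mul_le_mul_of_nonneg_right hKlt.le hA0
      have h4 : (L / (η * g) + 1) * A + 1 = C₁ * Real.log n + C₂ := by
        rw [hC₁, hC₂, hL, hL3]; ring
      linarith
    have h5 : ((k₁ + D * K' : ℕ) : ℝ) ≤ (slyK θ n : ℝ) := by
      push_cast
      linarith
    have h6 : k₁ + D * K' ≤ slyK θ n := by exact_mod_cast h5
    have hd3 : (3 : ℝ) ≤ d := by exact_mod_cast hd
    have h7 : ((1 : ℕ) : ℝ) ≤ (n : ℝ) ^ (θ / 4) / ((d : ℝ) - 1) := by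
      rw [le_div_iff₀ (show (0 : ℝ) < (d : ℝ) - 1 by linarith)]
      push_cast
      linarith [Real.rpow_nonneg hnpos.le (θ / 4)]
    have h8 := mul_slyK_le_slyM hd hθ n 1 h7
    rw [one_mul] at h8
    rw [hcard]
    exact h6.trans h8
  · -- the sector inequality `K D Lρ ≤ K D max(Lρ, 0) ≤ κ₁ LB`
    have h1 : (K' : ℝ) * D * Lρ ≤ (K' : ℝ) * D * max Lρ 0 :=
      mul_le_mul_of_nonneg_left (le_max_left _ _) (by positivity)
    have h2 : (K' : ℝ) * D * max Lρ 0 ≤ k₁ * LB := (div_le_iff₀ hLB).1 hkge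
    linarith
  · -- `1 + 2 log (3 n) = L ≤ K (η g)`
    have h1 : L ≤ K' * (η * g) := (div_le_iff₀ hηg).1 hKge
    rw [← hL, mul_assoc]
    exact h1

end Summit.PneNP.PneNP.Cruxes.MacroscopicTwinsAbove.LiteralGadgetsCfiApparatus
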